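import Literature.MathematicalPhysics.QuantumManyBody.CentreOfMassKineticEnergy
import Mathlib.Analysis.InnerProductSpace.Calculus
import Mathlib.Analysis.SpecialFunctions.Sqrt
import Mathlib.Analysis.SpecialFunctions.Pow.Real
import HarnessLib

/-!
# Crux `RigidMomentumBound` (stmt-AtomisticToContinuum-13034), line `registered`:
# auxiliary lemmas for the smearing step `stub_smearStep` (part 2: pointwise real analysis)

Supports (does not close) stmt-AtomisticToContinuum-13034. Pointwise facts for the regularised square
root `θ = √(η² + F) - η` of the smeared square `F`:

* `abs_fderiv_norm_sq_le` : `|D(‖Φ‖²)(Z) Y| ≤ 2 ‖Φ Z‖ ‖DΦ(Z) Y‖`;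
* `sqrtShift_sq_le`, `le_sqrtShift_sq_add` : `(√(η²+F) - η)² ≤ F ≤ (√(η²+F) - η)² + 2η√F`;
* `hasFDerivAt_sqrtShift`, `sq_fderiv_sqrtShift_le` : the derivative of `θ` is `DF/(2√(η²+F))`, and a
  bound `(DF Y)² ≤ 4 F G` (resp. `(DF D)² ≤ F U`) gives `(Dθ Y)² ≤ G` (resp. `(Dθ D)² ≤ U/4`).

All folklore real analysis.
-/

noncomputable section

open scoped ENNReal NNReal Topology InnerProductSpace

namespace Summit.AtomisticToContinuum.BoseEinsteinCondensation.Theorems.RigidMomentumBound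

namespace SmearStep

/-! ### The derivative of `‖Φ‖²` -/

/-- `|D(‖f‖²)(x) y| ≤ 2 ‖f x‖ ‖Df(x) y‖` for a differentiable `ℂ`-valued `f` (real inner product
structure on `ℂ`, Cauchy–Schwarz). [folklore] -/
theorem abs_fderiv_norm_sq_le {E : Type*} [NormedAddCommGroup E] [NormedSpace ℝ E]
    {f : E → ℂ} {x : E} (hf : DifferentiableAt ℝ f x) (y : E) :
    |fderiv ℝ (fun z => ‖f z‖ ^ 2) x y| ≤ 2 * ‖f x‖ * ‖fderiv ℝ f x y‖ := by
  rw [hf.hasFDerivAt.norm_sq.fderiv]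
  simp only [FunLike.coe_smul, Pi.smul_apply, ContinuousLinearMap.comp_apply,
    innerSL_apply_apply, nsmul_eq_mul, Nat.cast_ofNat]
  rw [abs_mul, abs_two, mul_assoc]
  gcongr
  exact abs_real_inner_le_norm _ _

/-! ### The regularised square root `√(η² + F) - η` -/

/-- `(√(η²+F) - η)² ≤ F` for `F ≥ 0`, `η ≥ 0`. [folklore] -/
theorem sqrtShift_sq_le {F η : ℝ} (hF : 0 ≤ F) (hη : 0 ≤ η) :
    (Real.sqrt (η ^ 2 + F) - η) ^ 2 ≤ F := by
  have h1 : Real.sqrt (η ^ 2 + F) ≤ η + Real.sqrt F := by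
    rw [Real.sqrt_le_left (by positivity)]
    nlinarith [Real.sq_sqrt hF, Real.sqrt_nonneg F]
  have h2 : η ≤ Real.sqrt (η ^ 2 + F) := by
    calc η = Real.sqrt (η ^ 2) := (Real.sqrt_sq hη).symm
      _ ≤ Real.sqrt (η ^ 2 + F) := Real.sqrt_le_sqrt (by linarith)
  have h3 : 0 ≤ Real.sqrt (η ^ 2 + F) - η := sub_nonneg.2 h2
  calc (Real.sqrt (η ^ 2 + F) - η) ^ 2 ≤ (Real.sqrt F) ^ 2 := by
        gcongr
        linarith
    _ = F := Real.sq_sqrt hF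

/-- `0 ≤ √(η²+F) - η` for `F ≥ 0`, `η ≥ 0`. [folklore] -/
theorem sqrtShift_nonneg {F η : ℝ} (hF : 0 ≤ F) (hη : 0 ≤ η) : 0 ≤ Real.sqrt (η ^ 2 + F) - η := by
  refine sub_nonneg.2 ?_
  calc η = Real.sqrt (η ^ 2) := (Real.sqrt_sq hη).symm
    _ ≤ Real.sqrt (η ^ 2 + F) := Real.sqrt_le_sqrt (by linarith)

/-- `F ≤ (√(η²+F) - η)² + 2η√F` for `F ≥ 0`, `η ≥ 0` (the regularisation loses at most `2η√F`).
[folklore] -/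
theorem le_sqrtShift_sq_add {F η : ℝ} (hF : 0 ≤ F) (hη : 0 ≤ η) :
    F ≤ (Real.sqrt (η ^ 2 + F) - η) ^ 2 + 2 * η * Real.sqrt F := by
  have hs : Real.sqrt (η ^ 2 + F) ≤ η + Real.sqrt F := by
    rw [Real.sqrt_le_left (by positivity)]
    nlinarith [Real.sq_sqrt hF, Real.sqrt_nonneg F]
  have hsq : Real.sqrt (η ^ 2 + F) ^ 2 = η ^ 2 + F := Real.sq_sqrt (by positivity)
  nlinarith [hsq, hs, Real.sqrt_nonneg F]

/-- `√(η² + F) - η = 0` when `F = 0` (`η ≥ 0`) (registered sub-goal anchoring this helper file on the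
crux item). [folklore] -/
theorem sqrtShift_eq_zero : ∀ {η : ℝ}, 0 ≤ η → Real.sqrt (η ^ 2 + 0) - η = 0 := by
  intro η hη
  rw [add_zero, Real.sqrt_sq hη, sub_self]

/-- Derivative of the regularised square root: if `F` has derivative `F'` at `X` and `η² + F X > 0`
then `θ = √(η² + F) - η` has derivative `(2√(η² + F X))⁻¹ • F'`. [folklore] -/
theorem hasFDerivAt_sqrtShift {E : Type*} [NormedAddCommGroup E] [NormedSpace ℝ E] {F : E → ℝ}
    {F' : E →L[ℝ] ℝ} {X : E} (hF : HasFDerivAt F F' X) {η : ℝ} (hpos : 0 < η ^ 2 + F X) :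
    HasFDerivAt (fun Z => Real.sqrt (η ^ 2 + F Z) - η)
      ((1 / (2 * Real.sqrt (η ^ 2 + F X))) • F') X := by
  have h1 : HasFDerivAt (fun Z => η ^ 2 + F Z) F' X := by
    simpa using hF.const_add (η ^ 2)
  have h2 := h1.sqrt hpos.ne'
  exact h2.sub_const η

/-- **From a bound on `(DF)²` to a bound on `(Dθ)²`.** If `(F' Y)² ≤ 4 F(X) G` with `F X, G ≥ 0` and
`η > 0`, then `((2√(η²+F X))⁻¹ F' Y)² ≤ G`. [folklore] -/
theorem sq_smul_deriv_le {FX G d η : ℝ} (hFX : 0 ≤ FX) (hG : 0 ≤ G) (hη : 0 < η)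
    (h : d ^ 2 ≤ 4 * FX * G) :
    ((1 / (2 * Real.sqrt (η ^ 2 + FX))) * d) ^ 2 ≤ G := by
  have hpos : 0 < η ^ 2 + FX := by positivity
  have hsq : Real.sqrt (η ^ 2 + FX) ^ 2 = η ^ 2 + FX := Real.sq_sqrt hpos.le
  have hspos : 0 < Real.sqrt (η ^ 2 + FX) := Real.sqrt_pos.2 hpos
  rw [mul_pow, div_pow, one_pow, mul_pow, hsq]
  rw [div_mul_eq_mul_div, one_mul, div_le_iff₀ (by positivity)]
  nlinarith [mul_nonneg hη.le hη.le, mul_nonneg (sq_nonneg η) hG]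

/-- **Rigid version.** If `(F' D)² ≤ F(X) U` with `F X, U ≥ 0` and `η > 0`, then
`((2√(η²+F X))⁻¹ F' D)² ≤ U/4`. [folklore] -/
theorem sq_smul_deriv_le_quarter {FX U d η : ℝ} (hFX : 0 ≤ FX) (hU : 0 ≤ U) (hη : 0 < η)
    (h : d ^ 2 ≤ FX * U) :
    ((1 / (2 * Real.sqrt (η ^ 2 + FX))) * d) ^ 2 ≤ U / 4 := by
  have hpos : 0 < η ^ 2 + FX := by positivity
  have hsq : Real.sqrt (η ^ 2 + FX) ^ 2 = η ^ 2 + FX := Real.sq_sqrt hpos.le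
  rw [mul_pow, div_pow, one_pow, mul_pow, hsq]
  rw [div_mul_eq_mul_div, one_mul, div_le_div_iff₀ (by positivity) (by norm_num)]
  nlinarith [mul_nonneg (sq_nonneg η) hU]

end SmearStep

end Summit.AtomisticToContinuum.BoseEinsteinCondensation.Theorems.RigidMomentumBound

end
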